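import Mathlib
import Summits.Ventures.PercRepro.TriangleCapBandLocusLevel
import Summits.Ventures.PercRepro.TriangleCapLevelLocus

/-!
# PercRepro — THE VALUE AT A VERTEX AS AN IFF, AND THE LOCI AT THE TWO ENDS OF EVERY BAND (p3, gen 51; part 235)

* `layer_value_iff`: at ANY vertex `w` with `t` off-edges (`1 ≤ deg w`) of a triangle-free graph with `s` edges,
  `Σ d² + 2 t (s − t − 1) + 2 j = s (s + 1)` iff `2·attach + offAdjPairs + 2 j = t (t + 1)` — the vertex decomposition
  read as an equivalence; with `layer_band_locus` the band value pins the layer.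
* THE BOTTOM OF THE BAND (`band_bottom_locus`, `j = t (t + 1) / 2`): a graph at `s (s + 1) − 2 t (s − t − 1) − t (t + 1)`
  has a vertex `w` of degree `s − t` whose `t` off-edges are pairwise disjoint and avoid `N(w)`: the star at `w`
  plus a matching disjoint from the star.
* THE TOP OF THE BAND (`band_top_locus`, `j = 0`): the `t` off-edges form a star at one vertex, each meeting `N(w)`
  (the level locus of part 216 reached from the value).
Axioms: standard.
-/

namespace PercRepro

namespace TriangleCap

namespace C047

open Finset

variable {V : Type*} [Fintype V] [DecidableEq V]

/-- **THE VALUE AT A VERTEX, AS AN IFF:** for a vertex `w` with `t = s − deg w` off-edges (`1 ≤ deg w`),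
`Σ d² + 2 t (s − t − 1) + 2 j = s (s + 1) ↔ 2·attach + offAdjPairs + 2 j = t (t + 1)`. -/
theorem layer_value_iff (H : SimpleGraph V) [DecidableRel H.Adj] (s t j : ℕ) (hm : H.edgeFinset.card = s) (w : V)
    (hw : 1 ≤ deg H w) (ht : (offEdges H w).card = t) :
    ∑ v, deg H v * deg H v + 2 * (t * (s - t - 1)) + 2 * j = s * (s + 1) ↔
      2 * attach H w + offAdjPairs H w + 2 * j = t * (t + 1) := by
  have hdec := sum_deg_sq_vertex_decomposition H w
  have hcard := card_offEdges_add_deg H w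
  rw [ht, hm] at hcard
  rw [ht] at hdec
  obtain ⟨d', hd⟩ : ∃ d', deg H w = d' + 1 := ⟨deg H w - 1, by omega⟩
  rw [hd] at hdec hcard
  obtain rfl : s = d' + 1 + t := by omega
  have e : d' + 1 + t - t - 1 = d' := by omega
  rw [e, hdec]
  constructor
  · intro h
    zify at h ⊢
    linear_combination h
  · intro h
    zify at h ⊢
    linear_combination h

/-- **THE BOTTOM OF THE BAND** (`1 ≤ t`, `4 t + 3 ≤ s`, `2 s ≥ 4 t + 6 + t (t + 1)`): a triangle-free graph with
`s` edges and `Σ d² + 2 t (s − t − 1) + t (t + 1) = s (s + 1)` has a vertex `w` of degree `s − t` whose `t` off-edges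
avoid `N(w)` and are pairwise disjoint — the star at `w` plus a matching disjoint from it. -/
theorem band_bottom_locus (H : SimpleGraph V) [DecidableRel H.Adj] (hfree : H.CliqueFree 3) (t s : ℕ) (ht : 1 ≤ t)
    (hs : 4 * t + 6 + t * (t + 1) ≤ 2 * s) (hs4 : 4 * t + 3 ≤ s) (hm : H.edgeFinset.card = s)
    (hS : ∑ v, deg H v * deg H v + 2 * (t * (s - t - 1)) + t * (t + 1) = s * (s + 1)) :
    ∃ w, deg H w + t = s ∧ (offEdges H w).card = t ∧
      (∀ e ∈ offEdges H w, ∀ v ∈ e, ¬ H.Adj w v) ∧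
      (∀ e ∈ offEdges H w, ∀ f ∈ offEdges H w, e ≠ f → ∀ v, v ∈ e → v ∉ f) := by
  have ht2 : Even (t * (t + 1)) := Nat.even_mul_succ_self t
  obtain ⟨j, hj⟩ := ht2
  have hS' : ∑ v, deg H v * deg H v + 2 * (t * (s - t - 1)) + 2 * j = s * (s + 1) := by omega
  obtain ⟨w, hw, hoff, hloc⟩ := layer_band_locus H hfree t s ht hs hs4 hm j (by omega) hS'
  have hA : attach H w = 0 := by omega
  have hP : offAdjPairs H w = 0 := by omega
  refine ⟨w, hw, hoff, ?_, ?_⟩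
  · -- `attach = 0`: no off-edge meets `N(w)`
    rw [attach_eq_sum_card, sum_eq_zero_iff] at hA
    intro e he v hv hadj
    have h0 := hA e he
    rw [card_eq_zero, filter_eq_empty_iff] at h0
    exact h0 (mem_univ v) ⟨hadj, hv⟩
  · -- `offAdjPairs = 0`: no two distinct off-edges share a vertex
    intro e he f hf hef v hve hvf
    unfold offAdjPairs at hP
    rw [card_eq_zero, filter_eq_empty_iff] at hP
    have hmem : (e, f) ∈ (offEdges H w).offDiag := mem_offDiag.mpr ⟨he, hf, hef⟩
    exact hP hmem ⟨v, hve, hvf⟩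

/-- **THE TOP OF THE BAND** (`2 ≤ t`, `4 t + 3 ≤ s`, `2 s ≥ 4 t + 6 + t (t + 1)`): a triangle-free graph with `s`
edges and `Σ d² + 2 t (s − t − 1) = s (s + 1)` has a vertex `w` of degree `s − t` whose `t` off-edges form a star at
a vertex `u`, each meeting `N(w)` in exactly one vertex. -/
theorem band_top_locus (H : SimpleGraph V) [DecidableRel H.Adj] (hfree : H.CliqueFree 3) (t s : ℕ) (ht : 2 ≤ t)
    (hs : 4 * t + 6 + t * (t + 1) ≤ 2 * s) (hs4 : 4 * t + 3 ≤ s) (hm : H.edgeFinset.card = s)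
    (hS : ∑ v, deg H v * deg H v + 2 * (t * (s - t - 1)) = s * (s + 1)) :
    ∃ w, deg H w + t = s ∧ (offEdges H w).card = t ∧
      ∃ u, (∀ e ∈ offEdges H w, u ∈ e) ∧
        ∀ e ∈ offEdges H w, (univ.filter (fun v => H.Adj w v ∧ v ∈ e)).card = 1 := by
  obtain ⟨w, hw, hoff, -⟩ := layer_band_locus H hfree t s (by omega) hs hs4 hm 0 (by omega) (by simpa using hS)
  refine ⟨w, hw, hoff, ?_⟩
  have hw1 : 1 ≤ deg H w := by omega
  have hS' : ∑ v, deg H v * deg H v + 2 * ((offEdges H w).card * (deg H w - 1)) =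
      H.edgeFinset.card * (H.edgeFinset.card + 1) := by
    rw [hoff, hm]
    have e : deg H w - 1 = s - t - 1 := by omega
    rw [e]
    exact hS
  exact level_locus H hfree w hw1 (by omega) hS'

/-- **THE BOTTOM OF THE BAND ON THE CELL** (`3 ≤ a`, `1 ≤ t`, `4 t + 3 ≤ r`, `2 r ≥ 4 t + 6 + t (t + 1)`, `2 a + r ≤ k`
(`r + 7 ≤ k` at `a = 3`), `2 t (r − t − 1) + t (t + 1) < stabGapFull k a r`): a `K₄⁻`-free graph at
`closed − (2 t (r − t − 1) + t (t + 1))` is `a`-bipartite and its missing graph is a star at `w` (degree `r − t`)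
plus `t` pairwise disjoint missing pairs avoiding the star's leaves. -/
theorem cherry_band_bottom_locus (k a r t : ℕ) (ha3 : 3 ≤ a) (ht : 1 ≤ t) (hr : 4 * t + 6 + t * (t + 1) ≤ 2 * r)
    (hr4 : 4 * t + 3 ≤ r) (hk : 2 * a + r ≤ k) (hk3 : a = 3 → r + 7 ≤ k)
    (hlt : 2 * (t * (r - t - 1)) + t * (t + 1) < stabGapFull k a r)
    (D : SimpleGraph (Fin k)) [DecidableRel D.Adj] (hK : K4mFree D) (hm : D.edgeFinset.card + r = a * (k - a))
    (heq : ∑ v, deg D v * deg D v + r * (k - 1 - r) + (2 * (t * (r - t - 1)) + t * (t + 1)) =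
      D.edgeFinset.card * k) :
    ∃ A : Finset (Fin k), A.card = a ∧ BipSub D A ∧
      ∃ w, deg (missingGraph D A) w + t = r ∧ (offEdges (missingGraph D A) w).card = t ∧
        (∀ e ∈ offEdges (missingGraph D A) w, ∀ v ∈ e, ¬ (missingGraph D A).Adj w v) ∧
        (∀ e ∈ offEdges (missingGraph D A) w, ∀ f ∈ offEdges (missingGraph D A) w, e ≠ f →
          ∀ v, v ∈ e → v ∉ f) := by
  have hcard : Fintype.card (Fin k) = k := Fintype.card_fin k
  have hbip : ∃ A : Finset (Fin k), A.card = a ∧ BipSub D A := by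
    by_contra hnb
    have h := (stab_table_rows_ge_three k a r ha3 hk (by omega) hk3).1 D hK hm hnb
    omega
  obtain ⟨A, hA, hB⟩ := hbip
  refine ⟨A, hA, hB, ?_⟩
  have hH := bipSub_sum_deg_sq_add_disjEdgePairs D A hB a r hA (by rw [hcard]; exact hm) (by rw [hcard]; omega)
  rw [hcard] at hH
  have hr' : (missingGraph D A).edgeFinset.card = r := card_edges_missingGraph D A hB a r hA (by rw [hcard]; exact hm)
  have hid := sum_deg_sq_add_disjEdgePairs (missingGraph D A)
  rw [hr'] at hid
  have hS : ∑ v, deg (missingGraph D A) v * deg (missingGraph D A) v + 2 * (t * (r - t - 1)) + t * (t + 1) =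
      r * (r + 1) := by
    omega
  exact band_bottom_locus (missingGraph D A) (cliqueFree_of_bipSub _ A (bipSub_missingGraph D A)) t r ht hr hr4 hr' hS

end C047

end TriangleCap

end PercRepro
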